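import Summits.QuantumFields.YangMills.Theorems.BalabanUVNodesN07PointFeasibilityOneLevelEnergyBound
import Summits.QuantumFields.YangMills.Theorems.BalabanUVNodesN07PointFeasibilityEnergyIdentity
import HarnessLib

/-!
# DAG node N07 [B11], road R0′ ∕ (L4) road v1 — (S1) IN THE TILE-CRITERION LETTERS: on the cubic one-level torus `TorusSite d (n·N₀)` tiled by the
# `n`-blocks with centres `ny + c₀`, every REAL `μ` with tile-constant `Δ²μ` satisfies `Σ_x β(tile x)·(μ x − μ(ctr(tile x))) ≤ 0` — the SHARP one-level
# margin «K ≥ K₀» (this lineage, b05's complex letters) read in dag-n07-w7 g3's real `TorusSite`∕`lap`∕`tile`∕`ctr` letters; hence `hK` of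
# `pointFeasibility_of_kPositivity` at one level and (P) one level re-derived there (the two frameworks agree) — first brick of the (S5) dictionary

Cell `pub-ymgap` (HUMAN RULINGS D-0062 ∕ D-0149 ∕ D-0154), width seat `pub-ymgap-dag-n07-w5` g3, CLAIM-5 ∕ INTENT-5 cell bus 2026-08-28.
`--kind proof --supports stmt-QuantumFields-27364 --as helper` (K1⁹ per dag-lead KEY MAP v2; count-neutral).  THEOREMS ONLY.

THE PRINT.  [B5] = `[Balaban1984PropagatorsI]` CMP **95** (1984) 17–40: (1.20) p. 20, (1.21) p. 21 («Δ is η-lattice Laplace operator»), Sect. C p. 22, (1.29)–(1.33) p. 23;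
[B6] = `[Balaban1984PropagatorsII]` CMP **96** (1984) 223–250: (2.22) p. 226; [I] = `[Balaban1987RG1]` CMP **109** (1987) 249–301: (0.4) p. 253.

WHY.  dag-n07-w7 g3's `…N07PointFeasibilityEnergyIdentity` states the tile criterion for `(P)_D` on `TorusSite d N = Fin d → ZMod N` for an ARBITRARY tiling
(`tile`, `ctr`) with the real Laplacian `lap`: `pointFeasibility_of_kPositivity` needs `hK : Σ_x β(tile x)·(μ x − μ(ctr(tile x))) < Σ_x (Δμ x)²`.  This lineage's
sharp one-level margin (p633313 ∘ dag-n07-w7 g5, constant ONE) lives in b05's COMPLEX letters on `Tor (fine n M)` with the matrix Laplacian `LapS` and reads, through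
FILE 2's dictionary (`…OneLevelEnergyBound.norm_sq_LapS_le_re_pairing`): `‖Δμ‖² ≤ Re⟨β′, μ∘centres⟩` whenever `Δ²μ = Q′ᴴβ′`.  On the CUBIC coarse torus
`M = fun _ => N₀` the carriers coincide (`Tor (fine n M) = TorusSite d (n·N₀)` by `rfl`), `LapS n = −n²·lap` on real functions, and `Q′ᴴβ′ = β∘blockOf` for
`β′ = n^{d+4}β`; so the sharp margin is EXACTLY «`K₀ = Σ(lap μ)² = Σ_x β(tile x)·μ x ≤ Σ_x β(tile x)·μ(ctr(tile x)) = K`», i.e. the centre functional of the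
tile criterion is `≤ 0` — with NO hypothesis on the centre values or the mean of `μ`.  (S5) of the (L4) road assembles `hK` for Bałaban's nested geometries from
such one-level bricks; this file supplies the one-level brick in the road's own letters.

WHAT THIS FILE DOES (namespace `Summit.QuantumFields.YangMills.BalabanUVNodes.N07PointFeasibilityOneLevelTileForm`; `M = fun _ => N₀`, `n` odd, `3 ≤ n`, `n = 2c₀+1`).
* §0 `lap_const_mul` · ★ `LapS_ofReal_apply` (`(LapS (fine n M) n *ᵥ μ_ℂ) x = −n²·lap μ x` for real `μ`, `μ_ℂ = (↑) ∘ μ`) · `LapS_LapS_ofReal_apply` (`= n⁴·lap(lap μ) x`) ·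
  `sum_comp_blockOf` (`Σ_x g(blockOf x) = n^d Σ_y g(y)`).
* §1 ★★★ `centreFunctional_le_zero` — `lap (lap μ) x = β (blockOf x)` for all `x` ⇒ `Σ_x β(blockOf x)·(μ x − μ(bpt (blockOf x) c₀)) ≤ 0`;
  `energy_le_centreForm` (the same as `Σ_x (lap μ x)² ≤ Σ_x β(blockOf x)·μ(bpt (blockOf x) c₀)`).
* §2 ★★ `kPositivity_oneLevel` (dag-n07-w7 g3's `hK` binder holds at one level) · ★ `pointFeasibility_oneLevel_tileForm` ((P) one level in the `TorusSite`∕`lap`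
  letters via `pointFeasibility_of_kPositivity`: centres constant ∧ tile-constant `Δ²μ` ⇒ `μ ≡ h`).

HONEST FRAMING (binding).  Count-neutral helper; dictionary bookkeeping on a CUBIC one-level torus BY NAME over p633313 ∕ p637106 (this lineage) and p619950 (dag-n07-w7 g3);
nothing of [B11]∕[B6]∕[B5]∕[3]'s analysis is asserted; the MULTI-LEVEL tile criterion ∕ (★) ∕ `(P)_D` for Bałaban's d = 4 nested geometries stays OPEN ((L4) road (S3)–(S5));
under road (a) of the K0 lineage nothing here is consumed — located-research insurance for the R0′-native junction.  `hker` at the record ∕ stub 1 ∕ K0⁷ ∕ K1⁹ NOT closed;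
N07 NOT discharged; counts unmoved; no summit statement is proved by this seat — R4 closes the conditional finite-𝕋⁴ rung `BalabanLadder.UV` only; nothing continuum ∕ ℝ⁴ ∕
OS ∕ mass gap ∕ Clay.  No `sorry`, no `def`, no `instance`, no `notation`.
-/

noncomputable section

open scoped BigOperators Matrix ComplexConjugate

namespace Summit.QuantumFields.YangMills.BalabanUVNodes.N07PointFeasibilityOneLevelTileForm

open Literature.MathematicalPhysics.QuantumFieldTheory.Balaban1983to89
open Literature.Probability.LatticeModels (TorusSite)
open B5Prop11Plancherel (Tor fine)
open B5Block118 (bpt QsOp)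
open B5Blocks16 (blockOf bpt_bijective blockOf_bpt)
open B5Action121 (LapS)
open B5Adjoint130 (QsOp_adjoint_mulVec)
open Summit.QuantumFields.YangMills.Theorems.N07PointFeasibilityEnergyIdentity (lap sum_mul_lap_comm pointFeasibility_of_kPositivity)
open N07PointFeasibilityOneLevelEnergyBound (norm_sq_LapS_le_re_pairing)

variable {d : ℕ} (n N₀ : ℕ) [NeZero n] [NeZero N₀]

/-! ## §0  The cubic one-level torus: `Tor (fine n (fun _ => N₀)) = TorusSite d (n·N₀)`, `LapS n = −n²·lap` on real functions, block sums -/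

section Letters

omit [NeZero n] [NeZero N₀] in
/-- `lap` commutes with constant multiples. [folklore] -/
theorem lap_const_mul {L : ℕ} (a : ℝ) (f : TorusSite d L → ℝ) (x : TorusSite d L) :
    lap (fun y => a * f y) x = a * lap f x := by
  simp only [lap, Finset.mul_sum]
  exact Finset.sum_congr rfl fun i _ => by ring

/-- ★ **`LapS n = −n²·lap` on real functions** of the cubic one-level torus (`Tor (fine n (fun _ => N₀))` IS `TorusSite d (n·N₀)`; b05's `unitVec` is `Pi.single · 1`):
`(LapS (fine n M) n *ᵥ μ_ℂ)(x) = −n²·(lap μ)(x)` with `μ_ℂ = (↑) ∘ μ`. [cite: Balaban1984PropagatorsI, (1.21) p.21] -/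
theorem LapS_ofReal_apply (μ : TorusSite d (n * N₀) → ℝ) (x : Tor (fine n (fun _ : Fin d => N₀))) :
    (LapS (fine n (fun _ : Fin d => N₀)) (n : ℂ) *ᵥ (fun z => ((μ z : ℝ) : ℂ))) x = -((n : ℂ) ^ 2) * ((lap μ x : ℝ) : ℂ) := by
  rw [B5Action121.LapS_mulVec, lap, Complex.ofReal_sum, Finset.mul_sum]
  refine Finset.sum_congr rfl fun ν _ => ?_
  rw [Complex.conj_natCast]
  push_cast
  simp only [B5Prop11Plancherel.unitVec]
  ring

/-- … hence `(LapS n)² μ_ℂ = n⁴·lap (lap μ)`. [cite: Balaban1984PropagatorsI, (1.21) p.21] -/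
theorem LapS_LapS_ofReal_apply (μ : TorusSite d (n * N₀) → ℝ) (x : Tor (fine n (fun _ : Fin d => N₀))) :
    (LapS (fine n (fun _ : Fin d => N₀)) (n : ℂ) *ᵥ (LapS (fine n (fun _ : Fin d => N₀)) (n : ℂ) *ᵥ (fun z => ((μ z : ℝ) : ℂ)))) x =
      ((n : ℂ) ^ 4) * ((lap (lap μ) x : ℝ) : ℂ) := by
  have h1 : (LapS (fine n (fun _ : Fin d => N₀)) (n : ℂ) *ᵥ (fun z => ((μ z : ℝ) : ℂ))) =
      fun z => (((-((n : ℝ) ^ 2) * lap μ z : ℝ)) : ℂ) := by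
    funext z
    rw [LapS_ofReal_apply]
    push_cast
    ring
  rw [h1, LapS_ofReal_apply, lap_const_mul]
  push_cast
  ring

/-- Block sums on the cubic one-level torus: `Σ_x g(blockOf x) = n^d·Σ_y g(y)`. [cite: Balaban1984PropagatorsI, (1.6) p.18, (1.20) p.20] -/
theorem sum_comp_blockOf (g : Tor (fun _ : Fin d => N₀) → ℝ) :
    ∑ x : Tor (fine n (fun _ : Fin d => N₀)), g (blockOf n (fun _ : Fin d => N₀) x) = (n : ℝ) ^ d * ∑ y, g y := by
  rw [← (bpt_bijective n (fun _ : Fin d => N₀)).sum_comp (fun x => g (blockOf n (fun _ : Fin d => N₀) x)), Fintype.sum_prod_type,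
    Finset.mul_sum]
  refine Finset.sum_congr rfl fun y _ => ?_
  simp only [blockOf_bpt, Finset.sum_const, Finset.card_univ, Fintype.card_pi, Fintype.card_fin, Finset.prod_const, nsmul_eq_mul,
    Nat.cast_pow]

end Letters

/-! ## §1  The sharp margin in the tile-criterion letters: the centre functional is `≤ 0` -/

section Margin

/-- **`K₀ ≤ K` at one level**: `n` odd, `3 ≤ n`, `n = 2c₀+1`; every REAL `μ` on `TorusSite d (n·N₀)` with tile-constant `lap (lap μ) x = β (blockOf x)` satisfies
`Σ_x (lap μ x)² ≤ Σ_x β(blockOf x)·μ(bpt (blockOf x) c₀)` — this lineage's sharp margin `norm_sq_LapS_le_re_pairing` (p637106 ∘ p633313 ∘ dag-n07-w7 g5) for `μ_ℂ`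
with the rescaled density `β′ = n^{d+4}β`, divided by `n⁴`. [cite: Balaban1984PropagatorsI, Sect. C p.22, (1.29)-(1.33) p.23; Balaban1984PropagatorsII, (2.22) p.226;
Balaban1987RG1, (0.4) p.253] -/
theorem energy_le_centreForm (hn : Odd n) (h3 : 3 ≤ n) (c₀ : Fin d → Fin n) (hc₀ : ∀ ν, 2 * (c₀ ν : ℕ) + 1 = n)
    (μ : TorusSite d (n * N₀) → ℝ) (β : Tor (fun _ : Fin d => N₀) → ℝ)
    (hβ : ∀ x : Tor (fine n (fun _ : Fin d => N₀)), lap (lap μ) x = β (blockOf n (fun _ : Fin d => N₀) x)) :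
    ∑ x : Tor (fine n (fun _ : Fin d => N₀)), lap μ x ^ 2 ≤
      ∑ x : Tor (fine n (fun _ : Fin d => N₀)), β (blockOf n (fun _ : Fin d => N₀) x) * μ (bpt n (fun _ : Fin d => N₀) (blockOf n (fun _ : Fin d => N₀) x) c₀) := by
  have hn0 : (n : ℝ) ≠ 0 := by exact_mod_cast NeZero.ne n
  have hnc : (n : ℂ) ≠ 0 := by exact_mod_cast NeZero.ne n  -- used by `field_simp`
  -- complexification `μc` and the rescaled density `β′ = n^{d+4}β`
  obtain ⟨μc, hμc⟩ : ∃ μc : Tor (fine n (fun _ : Fin d => N₀)) → ℂ, μc = fun z => ((μ z : ℝ) : ℂ) := ⟨_, rfl⟩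
  obtain ⟨β', hβ'⟩ : ∃ β' : Tor (fun _ : Fin d => N₀) → ℂ, β' = fun y => (((n : ℝ) ^ (d + 4) * β y : ℝ) : ℂ) := ⟨_, rfl⟩
  have hbi : LapS (fine n (fun _ : Fin d => N₀)) (n : ℂ) *ᵥ (LapS (fine n (fun _ : Fin d => N₀)) (n : ℂ) *ᵥ μc) =
      (QsOp n (fun _ : Fin d => N₀))ᴴ *ᵥ β' := by
    funext x
    rw [hμc, LapS_LapS_ofReal_apply, QsOp_adjoint_mulVec, hβ', hβ x]
    push_cast
    field_simp
    ring
  have h := norm_sq_LapS_le_re_pairing n (fun _ : Fin d => N₀) hn h3 c₀ hc₀ μc β' (fun y => μc (bpt n (fun _ : Fin d => N₀) y c₀)) hbi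
    (fun _ => rfl) 0
  -- left side: `n⁴ Σ (lap μ)²`
  have hL : ∑ x, ‖(LapS (fine n (fun _ : Fin d => N₀)) (n : ℂ) *ᵥ μc) x‖ ^ 2 =
      (n : ℝ) ^ 4 * ∑ x : Tor (fine n (fun _ : Fin d => N₀)), lap μ x ^ 2 := by
    rw [Finset.mul_sum]
    refine Finset.sum_congr rfl fun x _ => ?_
    rw [hμc, LapS_ofReal_apply, norm_mul, norm_neg, norm_pow, Complex.norm_natCast, Complex.norm_real, Real.norm_eq_abs, mul_pow, sq_abs]
    ring
  -- right side: `n^{d+4} Σ_y β(y) μ(c_y)`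
  have hR : (star β' ⬝ᵥ fun y => μc (bpt n (fun _ : Fin d => N₀) y c₀) - 0).re =
      (n : ℝ) ^ (d + 4) * ∑ y : Tor (fun _ : Fin d => N₀), β y * μ (bpt n (fun _ : Fin d => N₀) y c₀) := by
    simp only [sub_zero, dotProduct, Pi.star_apply, hβ', hμc, Complex.star_def, Complex.conj_ofReal, ← Complex.ofReal_mul,
      ← Complex.ofReal_sum, Complex.ofReal_re, Finset.mul_sum]
    exact Finset.sum_congr rfl fun y _ => by ring
  rw [hL, hR, pow_add, show (n : ℝ) ^ d * (n : ℝ) ^ 4 = (n : ℝ) ^ 4 * (n : ℝ) ^ d from mul_comm _ _, mul_assoc] at h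
  have h' : ∑ x : Tor (fine n (fun _ : Fin d => N₀)), lap μ x ^ 2 ≤
      (n : ℝ) ^ d * ∑ y : Tor (fun _ : Fin d => N₀), β y * μ (bpt n (fun _ : Fin d => N₀) y c₀) :=
    le_of_mul_le_mul_left h (by positivity)
  rw [← sum_comp_blockOf n N₀ (fun y => β y * μ (bpt n (fun _ : Fin d => N₀) y c₀))] at h'
  exact h'

/-- ★★★ **THE CENTRE FUNCTIONAL IS NON-POSITIVE (sharp one-level margin, tile-criterion letters).**  `n` odd, `3 ≤ n`, `n = 2c₀+1`; tiles = the `n`-blocks of the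
cubic one-level torus `TorusSite d (n·N₀)`, centres `ctr y = bpt y c₀`.  For EVERY real `μ` with `lap (lap μ) x = β (blockOf x)` (tile-constant `Δ²μ`):
`Σ_x β(blockOf x)·(μ x − μ(bpt (blockOf x) c₀)) ≤ 0` — no hypothesis on the centre values or on the mean of `μ`.  (`Σ_x β(tile x)μ x = Σ (lap μ)²` by the symmetry
of `lap`, dag-n07-w7 g3 `sum_mul_lap_comm`; then `energy_le_centreForm`.) [cite: Balaban1984PropagatorsII, (2.22) p.226; Balaban1987RG1, (0.4) p.253] -/
theorem centreFunctional_le_zero (hn : Odd n) (h3 : 3 ≤ n) (c₀ : Fin d → Fin n) (hc₀ : ∀ ν, 2 * (c₀ ν : ℕ) + 1 = n)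
    (μ : TorusSite d (n * N₀) → ℝ) (β : Tor (fun _ : Fin d => N₀) → ℝ)
    (hβ : ∀ x : Tor (fine n (fun _ : Fin d => N₀)), lap (lap μ) x = β (blockOf n (fun _ : Fin d => N₀) x)) :
    ∑ x : Tor (fine n (fun _ : Fin d => N₀)),
        β (blockOf n (fun _ : Fin d => N₀) x) * (μ x - μ (bpt n (fun _ : Fin d => N₀) (blockOf n (fun _ : Fin d => N₀) x) c₀)) ≤ 0 := by
  have hE : ∑ x : Tor (fine n (fun _ : Fin d => N₀)), β (blockOf n (fun _ : Fin d => N₀) x) * μ x =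
      ∑ x : Tor (fine n (fun _ : Fin d => N₀)), lap μ x ^ 2 := by
    have h1 := sum_mul_lap_comm (N := n * N₀) μ (lap μ)
    calc ∑ x : Tor (fine n (fun _ : Fin d => N₀)), β (blockOf n (fun _ : Fin d => N₀) x) * μ x
        = ∑ x : TorusSite d (n * N₀), μ x * lap (lap μ) x := Finset.sum_congr rfl fun x _ => by rw [hβ x, mul_comm]
      _ = ∑ x : TorusSite d (n * N₀), lap μ x ^ 2 := by rw [h1]; exact Finset.sum_congr rfl fun x _ => by ring
  have h := energy_le_centreForm n N₀ hn h3 c₀ hc₀ μ β hβ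
  simp only [mul_sub, Finset.sum_sub_distrib, hE]
  linarith

end Margin

/-! ## §2  dag-n07-w7 g3's `hK` at one level, and (P) one level re-derived in the `TorusSite` letters -/

section KPositivity

/-- ★★ **K-positivity at one level** — the `hK` binder of dag-n07-w7 g3's `pointFeasibility_of_kPositivity` HOLDS for the one-level block tiling of the cubic torus
(`tile = blockOf`, `ctr y = bpt y c₀`): the centre functional is `≤ 0 <` the energy whenever the energy is positive.
[cite: Balaban1984PropagatorsII, (2.22) p.226; Balaban1987RG1, (0.4) p.253] -/
theorem kPositivity_oneLevel (hn : Odd n) (h3 : 3 ≤ n) (c₀ : Fin d → Fin n) (hc₀ : ∀ ν, 2 * (c₀ ν : ℕ) + 1 = n)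
    (μ : TorusSite d (n * N₀) → ℝ) (β : Tor (fun _ : Fin d => N₀) → ℝ)
    (hβ : ∀ x : Tor (fine n (fun _ : Fin d => N₀)), lap (lap μ) x = β (blockOf n (fun _ : Fin d => N₀) x))
    (hpos : 0 < ∑ x : Tor (fine n (fun _ : Fin d => N₀)), lap μ x ^ 2) :
    ∑ x : Tor (fine n (fun _ : Fin d => N₀)),
        β (blockOf n (fun _ : Fin d => N₀) x) * (μ x - μ (bpt n (fun _ : Fin d => N₀) (blockOf n (fun _ : Fin d => N₀) x) c₀)) <
      ∑ x : Tor (fine n (fun _ : Fin d => N₀)), lap μ x ^ 2 :=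
  (centreFunctional_le_zero n N₀ hn h3 c₀ hc₀ μ β hβ).trans_lt hpos

/-- ★ **(P) ONE LEVEL in the `TorusSite` ∕ `lap` letters** (dag-n07-w7 g3's `pointFeasibility_of_kPositivity` ∘ `kPositivity_oneLevel`): on the cubic one-level torus with
odd `n ≥ 3`, a real `μ` taking ONE value `h` on all block centres `bpt y c₀` with tile-constant `lap (lap μ)` is identically `h` — the same theorem as g0′'s
`N07PointFeasibilityOneLevel.eq_const_of_biharmonic_of_centres` (b05 letters), re-derived through the tile criterion: the two frameworks agree.
[cite: Balaban1984PropagatorsII, (2.22) p.226, (2.35) p.228; Balaban1987RG1, (0.4) p.253] -/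
theorem pointFeasibility_oneLevel_tileForm (hn : Odd n) (h3 : 3 ≤ n) (c₀ : Fin d → Fin n) (hc₀ : ∀ ν, 2 * (c₀ ν : ℕ) + 1 = n)
    (μ : TorusSite d (n * N₀) → ℝ) (β : Tor (fun _ : Fin d => N₀) → ℝ) (h : ℝ)
    (hc : ∀ y : Tor (fun _ : Fin d => N₀), μ (bpt n (fun _ : Fin d => N₀) y c₀) = h)
    (hβ : ∀ x : Tor (fine n (fun _ : Fin d => N₀)), lap (lap μ) x = β (blockOf n (fun _ : Fin d => N₀) x))
    (x : TorusSite d (n * N₀)) : μ x = h := by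
  haveI : NeZero (n * N₀) := ⟨Nat.mul_ne_zero (NeZero.ne n) (NeZero.ne N₀)⟩
  refine pointFeasibility_of_kPositivity (N := n * N₀) (blockOf n (fun _ : Fin d => N₀)) (fun y => bpt n (fun _ : Fin d => N₀) y c₀)
    hc hβ (fun hpos => ?_) x
  exact kPositivity_oneLevel n N₀ hn h3 c₀ hc₀ μ β hβ hpos

end KPositivity

end Summit.QuantumFields.YangMills.BalabanUVNodes.N07PointFeasibilityOneLevelTileForm

end
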